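import Literature.NumberTheory.Automorphic.SymWeightCoefficients
import Literature.NumberTheory.Automorphic.SymPowBaseChange
import Literature.NumberTheory.Automorphic.LevelActionCoefficientTensor
import Literature.LinearAlgebra.BaseChange.PiTensorBaseChange
import Literature.LinearAlgebra.Semilinear.PiTensorProductSemilinear
import HarnessLib

/-!
# The `𝒪`-form `⨂_τ Sym^{k−2}(𝒪²)` of the Bianchi coefficients and its reductions

Topic `NumberTheory/Automorphic`; namespace `Literature.NumberTheory.Automorphic.ParallelWeight`;
definitions with bodies and theorems.  The integral coefficients of Hida theory for `Res_{F/ℚ} GL₂`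
([KhareThorne2017, §6.4]: "`M_𝛌 = ⊗_τ M_{λ_τ}`, an `𝒪[GL_n(𝒪_{F,p})]`-module, finite free over `𝒪`,
with `M_𝛌 ⊗_𝒪 E = ⊗_τ V_{λ_τ}`"; [Hida1994AIF, §1]: `L(n, v; A) = ⊗_σ L(n_σ; A)`), for an ABSTRACT
coefficient ring `𝒪` with ring maps `φO_τ : 𝒪_{F, v(τ)} → 𝒪` at chosen places `v(τ)` (in the
application `𝒪 ⊂ ℚ̄_p` a complete discrete valuation ring containing the `τ̂(𝒪_{F,v(τ)})`,
`v = padicPlace`, and `σ : 𝒪 → ℚ̄_p` the inclusion):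

* `integralMonoid F v` — the `g ∈ GL₂(𝔸_F^∞)` with `g_{v(τ)} ∈ M₂(𝒪_{F,v(τ)})` for all `τ`
  (contains `GL₂(𝒪̂_F)` ∩ …, all levels `U(b,c)` and the elements `t_v`), `intMatrixAt` — the
  `𝒪`-valued matrix `φO_τ(g_{v(τ)})`;
* `SymCoeffLattice 𝒪 F k = ⨂[𝒪]_τ Sym^{k−2}(𝒪²)` with the INTEGRAL action `symLatticeAction`
  `g ↦ ⊗_τ symPowAction(φO_τ(g_{v(τ)}))` of `integralMonoid` (a `LevelAction.tensorAction`, so the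
  coefficients-at-`p` cohomology `LevelAction.cohomology` applies verbatim);
* `latticeToCoeff σ : SymCoeffLattice 𝒪 F k →ₛₗ[σ] SymCoeffModule E F k` (coefficientwise `σ` in each
  factor), **equivariant** for `symAdelicRep` when `σ ∘ φO_τ = φ_τ` on `𝒪_{F,v(τ)}`
  (`latticeToCoeff_symLatticeAction`), **injective** for injective `σ` and **spanning**
  (`latticeToCoeff_injective`, `span_range_latticeToCoeff`: "`M ⊗ E = V`"), via the tensor
  monomial bases (`latticeBasis`, `repr_latticeToCoeff`);
* `latticeQuotEquiv I : SymCoeffLattice 𝒪 F k ⧸ I·(…) ≃ₗ[𝒪] SymCoeffLattice (𝒪 ⧸ I) F k` — **the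
  reduction modulo `I` (e.g. `(ϖ^r)`) of the `𝒪`-form is the `𝒪/I`-form** (`PiTensorBaseChange`,
  `SymPowBaseChange`), `latticeQuotEquiv_mk_tprod`, and its equivariance
  `latticeQuotEquiv_symLatticeAction` (the induced action on the quotient is `symLatticeAction` of
  `𝒪 ⧸ I` with `φO_τ mod I`) — the torsion coefficients `⨂_τ Sym^{k−2}((𝒪/ϖ^r)²)` of the
  independence-of-weight files.

## References

* C. Khare, J. A. Thorne, Amer. J. Math. 139 (2017), §6.4 (arXiv:1409.7007, held). [KhareThorne2017]
* H. Hida, Ann. Inst. Fourier 44 (1994), §1 (held). [Hida1994AIF]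
-/

noncomputable section

open scoped TensorProduct NumberField
open PiTensorProduct IsDedekindDomain

namespace Literature.NumberTheory.Automorphic.ParallelWeight

open BigHeckeGLn IntegralWeightGL2 LevelAction Literature.LinearAlgebra.BaseChange

variable (O : Type) [CommRing O] (E : Type) [Field E] (F : Type) [Field F] [NumberField F] (k : ℕ)
  (v : (F →+* E) → HeightOneSpectrum (𝓞 F))

/-! ### The integral monoid and the `𝒪`-valued local matrices -/

variable {O E k} in
/-- **The integral monoid**: `g ∈ GL₂(𝔸_F^∞)` with `g_{v(τ)} ∈ M₂(𝒪_{F,v(τ)})` for every `τ`.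
[cite: KhareThorne2017, §6.4] -/
def integralMonoid : Submonoid (FiniteAdelicGL 2 F) :=
  ⨅ τ : F →+* E, (integralAt F 2 (v τ)).comap (localComponent 2 F (v τ))

variable {E F v} in
/-- Membership in the integral monoid. [folklore] -/
theorem mem_integralMonoid_iff (g : FiniteAdelicGL 2 F) :
    g ∈ integralMonoid F v ↔ ∀ τ, localComponent 2 F (v τ) g ∈ integralAt F 2 (v τ) := by
  simp only [integralMonoid, Submonoid.mem_iInf, Submonoid.mem_comap]

variable {E} in
/-- The integral local component at `v(τ)`. [folklore] -/
def localIntAt (τ : F →+* E) : integralMonoid F v →* integralAt F 2 (v τ) where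
  toFun g := ⟨localComponent 2 F (v τ) g, (mem_integralMonoid_iff (g : FiniteAdelicGL 2 F)).1 g.2 τ⟩
  map_one' := Subtype.ext (by simp)
  map_mul' g h := Subtype.ext (by simp)

variable {E} in
/-- Unfolding `localIntAt`. [folklore] -/
@[simp]
theorem coe_localIntAt (τ : F →+* E) (g : integralMonoid F v) :
    (localIntAt F v τ g : GL (Fin 2) ((v τ).adicCompletion F)) = localComponent 2 F (v τ) g :=
  rfl

variable (φO : ∀ τ : F →+* E, (v τ).adicCompletionIntegers F →+* O)

variable {E} in
/-- **The `𝒪`-valued matrix `φO_τ(g_{v(τ)})` of `g` at `τ`**, multiplicatively. [cite: KhareThorne2017, §6.4] -/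
def intMatrixAt (τ : F →+* E) : integralMonoid F v →* Matrix (Fin 2) (Fin 2) O :=
  (φO τ).mapMatrix.toMonoidHom.comp ((toIntMatrix F 2 (v τ)).comp (localIntAt F v τ))

variable {E} in
/-- Entries of `intMatrixAt`. [folklore] -/
theorem intMatrixAt_apply (τ : F →+* E) (g : integralMonoid F v) (i j : Fin 2) :
    intMatrixAt O F v φO τ g i j = φO τ (toIntMatrix F 2 (v τ) (localIntAt F v τ g) i j) :=
  rfl

variable {E} in
/-- Changing `𝒪` along a ring map `f` changes `intMatrixAt` by `Matrix.map f`. [folklore] -/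
theorem intMatrixAt_map {O' : Type} [CommRing O'] (f : O →+* O') (τ : F →+* E) (g : integralMonoid F v) :
    (intMatrixAt O F v φO τ g).map f = intMatrixAt O' F v (fun τ => f.comp (φO τ)) τ g :=
  rfl

variable {E} in
/-- **Compatibility with the rational place data**: if `σ ∘ φO_τ = φ_τ` on `𝒪_{F,v(τ)}` then
`σ(intMatrixAt g) = GL₂(φ_τ)(g_{v(τ)})`. [folklore] -/
theorem intMatrixAt_map_eq (σ : O →+* E) (φ : ∀ τ : F →+* E, (v τ).adicCompletion F →+* E)
    (hφ : ∀ τ (y : (v τ).adicCompletionIntegers F), σ (φO τ y) = φ τ y) (τ : F →+* E)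
    (g : integralMonoid F v) :
    (intMatrixAt O F v φO τ g).map σ =
      ((Matrix.GeneralLinearGroup.map (φ τ) (localComponent 2 F (v τ) g) : GL (Fin 2) E) :
        Matrix (Fin 2) (Fin 2) E) := by
  ext i j
  rw [Matrix.map_apply, intMatrixAt_apply, hφ, Matrix.GeneralLinearGroup.map_apply,
    coe_toIntMatrix_apply, coe_localIntAt]

/-! ### The `𝒪`-form and its integral action -/

/-- **`⨂[𝒪]_τ Sym^{k−2}(𝒪²)`**, the `𝒪`-form of the Bianchi coefficients (a `def` carrying its
own instances — one instance path, as the tree's `CoeffModule`). [cite: KhareThorne2017, §6.4 (M_𝛌)] -/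
def SymCoeffLattice : Type :=
  ⨂[O] _τ : (F →+* E), SymPow O (k - 2)

/-- Additive group structure (that of the `PiTensorProduct`). [folklore] -/
instance : AddCommGroup (SymCoeffLattice O E F k) :=
  inferInstanceAs (AddCommGroup (⨂[O] _τ : (F →+* E), SymPow O (k - 2)))

/-- `𝒪`-module structure (that of the `PiTensorProduct`). [folklore] -/
instance : Module O (SymCoeffLattice O E F k) :=
  inferInstanceAs (Module O (⨂[O] _τ : (F →+* E), SymPow O (k - 2)))

/-- The `𝒪`-module structure of the `𝒪/I`-form (restriction of scalars along `𝒪 → 𝒪/I`, that of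
the `PiTensorProduct`). [folklore] -/
instance (I : Ideal O) : Module O (SymCoeffLattice (O ⧸ I) E F k) :=
  inferInstanceAs (Module O (⨂[O ⧸ I] _τ : (F →+* E), SymPow (O ⧸ I) (k - 2)))

/-- Compatibility of the two module structures of the `𝒪/I`-form. [folklore] -/
instance (I : Ideal O) : IsScalarTower O (O ⧸ I) (SymCoeffLattice (O ⧸ I) E F k) :=
  inferInstanceAs (IsScalarTower O (O ⧸ I) (⨂[O ⧸ I] _τ : (F →+* E), SymPow (O ⧸ I) (k - 2)))

variable {O E F k} in
/-- The pure tensors of the `𝒪`-form. [folklore] -/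
def ltprod (x : (F →+* E) → SymPow O (k - 2)) : SymCoeffLattice O E F k :=
  tprod O x

variable {O E F k} in
omit [NumberField F] in
/-- Induction on the `𝒪`-form (pure tensors span). [folklore] -/
theorem SymCoeffLattice.induction_on {motive : SymCoeffLattice O E F k → Prop} (z : SymCoeffLattice O E F k)
    (smul_tprod : ∀ (r : O) (x : (F →+* E) → SymPow O (k - 2)), motive (r • ltprod x))
    (add : ∀ x y, motive x → motive y → motive (x + y)) : motive z :=
  PiTensorProduct.induction_on (motive := motive) z smul_tprod add

/-- **The integral action `g ↦ ⊗_τ symPowAction(φO_τ(g_{v(τ)}))`** of the integral monoid on the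
`𝒪`-form. [cite: KhareThorne2017, §6.4] [cite: Hida1994AIF, §1] -/
def symLatticeAction : integralMonoid F v →* Module.End O (SymCoeffLattice O E F k) :=
  show integralMonoid F v →* Module.End O (⨂[O] _τ : (F →+* E), SymPow O (k - 2)) from
    tensorAction (integralMonoid F v) fun τ => (symPowAction O (k - 2)).comp (intMatrixAt O F v φO τ)

/-- `symLatticeAction` on pure tensors. [folklore] -/
@[simp]
theorem symLatticeAction_tprod (g : integralMonoid F v) (x : (F →+* E) → SymPow O (k - 2)) :
    symLatticeAction O E F k v φO g (ltprod x) =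
      ltprod fun τ => symPowAction O (k - 2) (intMatrixAt O F v φO τ g) (x τ) :=
  tensorAction_apply_tprod _ _ g x

/-! ### Comparison with the rational coefficients along `σ : 𝒪 → E` -/

section Compare

variable (σ : O →+* E)

/-- **`⨂_τ Sym^{k−2}(𝒪²) → ⨂_τ Sym^{k−2}(E²)`**, coefficientwise `σ` in each factor (a
`σ`-semilinear map). [cite: KhareThorne2017, §6.4 (M_𝛌 ⊗_𝒪 E)] -/
def latticeToCoeff : SymCoeffLattice O E F k →ₛₗ[σ] SymCoeffModule E F k :=
  show (⨂[O] _τ : (F →+* E), SymPow O (k - 2)) →ₛₗ[σ] SymCoeffModule E F k from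
    Literature.LinearAlgebra.Semilinear.PiTensorProduct.semimap fun _ => symPowMap σ (k - 2)

omit [NumberField F] in
/-- `latticeToCoeff` on pure tensors. [folklore] -/
@[simp]
theorem latticeToCoeff_tprod (x : (F →+* E) → SymPow O (k - 2)) :
    latticeToCoeff O E F k σ (ltprod x) = tprod E fun τ => symPowMap σ (k - 2) (x τ) :=
  Literature.LinearAlgebra.Semilinear.PiTensorProduct.semimap_tprod _ x

/-- **`latticeToCoeff` is equivariant**: for `σ ∘ φO_τ = φ_τ` on `𝒪_{F,v(τ)}`, it intertwines the
integral action with `symAdelicRep E F k v φ`. [cite: KhareThorne2017, §6.4] -/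
theorem latticeToCoeff_symLatticeAction (φ : ∀ τ : F →+* E, (v τ).adicCompletion F →+* E)
    (hφ : ∀ τ (y : (v τ).adicCompletionIntegers F), σ (φO τ y) = φ τ y) (g : integralMonoid F v)
    (x : SymCoeffLattice O E F k) :
    latticeToCoeff O E F k σ (symLatticeAction O E F k v φO g x) =
      symAdelicRep E F k v φ g (latticeToCoeff O E F k σ x) := by
  change Literature.LinearAlgebra.Semilinear.PiTensorProduct.semimap (fun _ => symPowMap σ (k - 2))
      (PiTensorProduct.map (fun τ => ((symPowAction O (k - 2)).comp (intMatrixAt O F v φO τ)) g) x) =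
    PiTensorProduct.map _
      (Literature.LinearAlgebra.Semilinear.PiTensorProduct.semimap (fun _ => symPowMap σ (k - 2)) x)
  refine Literature.LinearAlgebra.Semilinear.PiTensorProduct.semimap_map _ _ _ _ (fun τ y => ?_) x
  rw [MonoidHom.comp_apply, symPowMap_symPowAction, intMatrixAt_map_eq O F v φO σ φ hφ]
  rfl

variable [CharZero E]

/-- **The tensor monomial basis of the `𝒪`-form.** [folklore] -/
def latticeBasis : Module.Basis ((F →+* E) → Exponents (k - 2)) O (SymCoeffLattice O E F k) :=
  show Module.Basis ((F →+* E) → Exponents (k - 2)) O (⨂[O] _τ : (F →+* E), SymPow O (k - 2)) from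
    Basis.piTensorProduct fun _ => symPowBasis O (k - 2)

/-- The tensor monomial basis consists of the pure tensors of monomials. [folklore] -/
theorem latticeBasis_apply (d : (F →+* E) → Exponents (k - 2)) :
    latticeBasis O E F k d = ltprod fun τ => symPowMonomial O (k - 2) (d τ) := by
  change (Basis.piTensorProduct fun _ => symPowBasis O (k - 2)) d = _
  rw [Basis.piTensorProduct_apply]
  simp_rw [symPowBasis_apply]
  rfl

variable {O E} in
/-- `mapRange σ` as a `σ`-semilinear map of finitely supported functions. [folklore] -/
def mapRangeₛₗ {α : Type} : (α →₀ O) →ₛₗ[σ] (α →₀ E) where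
  toFun := Finsupp.mapRange σ (map_zero σ)
  map_add' x y := Finsupp.mapRange_add (map_add σ) x y
  map_smul' c x := by
    ext a
    simp only [Finsupp.mapRange_apply, Finsupp.coe_smul, Pi.smul_apply, smul_eq_mul, map_mul]

/-- **Coordinates of `latticeToCoeff x` are `σ` of the coordinates of `x`** (in the tensor monomial
bases). [folklore] -/
theorem repr_latticeToCoeff (x : SymCoeffLattice O E F k) :
    (latticeBasis E E F k).repr (show SymCoeffLattice E E F k from latticeToCoeff O E F k σ x) =
      Finsupp.mapRange σ (map_zero σ) ((latticeBasis O E F k).repr x) := by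
  have h : (latticeBasis E E F k).repr.toLinearMap.comp (latticeToCoeff O E F k σ) =
      (mapRangeₛₗ σ).comp (latticeBasis O E F k).repr.toLinearMap := by
    refine (latticeBasis O E F k).ext fun d => ?_
    rw [LinearMap.comp_apply, LinearMap.comp_apply, LinearEquiv.coe_coe, LinearEquiv.coe_coe,
      Module.Basis.repr_self]
    change (latticeBasis E E F k).repr (show SymCoeffLattice E E F k from
        latticeToCoeff O E F k σ (latticeBasis O E F k d)) =
      Finsupp.mapRange σ (map_zero σ) (Finsupp.single d 1)
    rw [Finsupp.mapRange_single, map_one, latticeBasis_apply, latticeToCoeff_tprod]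
    simp_rw [symPowMap_symPowMonomial]
    rw [← Module.Basis.repr_self (latticeBasis E E F k) d, latticeBasis_apply]
    rfl
  exact LinearMap.congr_fun h x

/-- **`latticeToCoeff` is injective for injective `σ`** (the `𝒪`-form is an `𝒪`-lattice in
`⨂_τ Sym^{k−2}(E²)`). [cite: KhareThorne2017, §6.4] -/
theorem latticeToCoeff_injective (hσ : Function.Injective σ) :
    Function.Injective (latticeToCoeff O E F k σ) := by
  refine (injective_iff_map_eq_zero _).2 fun x hx => ?_
  have h := repr_latticeToCoeff O E F k σ x
  have h0 : (show SymCoeffLattice E E F k from latticeToCoeff O E F k σ x) = 0 := hx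
  rw [h0, map_zero] at h
  refine (latticeBasis O E F k).repr.injective (Finsupp.ext fun d => ?_)
  have hd := DFunLike.congr_fun h d
  rw [Finsupp.zero_apply, Finsupp.mapRange_apply, eq_comm, map_eq_zero_iff σ hσ] at hd
  rw [hd, map_zero, Finsupp.zero_apply]

/-- **The image of the `𝒪`-form spans `⨂_τ Sym^{k−2}(E²)` over `E`** (`M ⊗_𝒪 E = V`).
[cite: KhareThorne2017, §6.4] -/
theorem span_range_latticeToCoeff :
    Submodule.span E (Set.range (latticeToCoeff O E F k σ)) = ⊤ := by
  refine eq_top_iff.2 ((latticeBasis E E F k).span_eq.ge.trans (Submodule.span_mono ?_))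
  rintro _ ⟨d, rfl⟩
  refine ⟨latticeBasis O E F k d, ?_⟩
  rw [latticeBasis_apply, latticeBasis_apply, latticeToCoeff_tprod]
  simp_rw [symPowMap_symPowMonomial]
  rfl

end Compare

/-! ### Reduction modulo an ideal: the `𝒪/I`-form -/

section Quotient

variable (I : Ideal O) [CharZero E]

/-- **`(⨂_τ Sym^{k−2}(𝒪²)) / I ≅ ⨂_τ Sym^{k−2}((𝒪/I)²)`**: the reduction of the `𝒪`-form is the
`𝒪/I`-form. [cite: KhareThorne2017, §6.4] [cite: Hida1994AIF, §1, (1.2b)] -/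
def latticeQuotEquiv :
    (SymCoeffLattice O E F k ⧸ (I • (⊤ : Submodule O (SymCoeffLattice O E F k)))) ≃ₗ[O]
      SymCoeffLattice (O ⧸ I) E F k :=
  (TensorProduct.quotTensorEquivQuotSMul (SymCoeffLattice O E F k) I).symm ≪≫ₗ
    (show (O ⧸ I) ⊗[O] (⨂[O] _τ : (F →+* E), SymPow O (k - 2)) ≃ₗ[O]
        ⨂[O ⧸ I] _τ : (F →+* E), SymPow (O ⧸ I) (k - 2) from
      (piTensorBaseChange (A := O ⧸ I) fun _ : F →+* E => symPowBasis O (k - 2)).restrictScalars O ≪≫ₗ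
        (PiTensorProduct.congr fun _ : F →+* E => symPowBaseChange (O ⧸ I) (k - 2)).restrictScalars O)

/-- **`latticeQuotEquiv` is reduction of coefficients** on pure tensors. [folklore] -/
@[simp]
theorem latticeQuotEquiv_mk_tprod (x : (F →+* E) → SymPow O (k - 2)) :
    latticeQuotEquiv O E F k I (Submodule.Quotient.mk (ltprod x)) =
      ltprod fun τ => symPowMap (Ideal.Quotient.mk I) (k - 2) (x τ) := by
  rw [latticeQuotEquiv, LinearEquiv.trans_apply]
  have h : (TensorProduct.quotTensorEquivQuotSMul (SymCoeffLattice O E F k) I).symm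
      (Submodule.Quotient.mk (ltprod x)) = (1 : O ⧸ I) ⊗ₜ ltprod x := by
    rw [LinearEquiv.symm_apply_eq, ← map_one (Ideal.Quotient.mk I),
      TensorProduct.quotTensorEquivQuotSMul_mk_tmul, one_smul]
  rw [h]
  change (PiTensorProduct.congr fun _ : F →+* E => symPowBaseChange (O ⧸ I) (k - 2))
      ((piTensorBaseChange (A := O ⧸ I) fun _ : F →+* E => symPowBasis O (k - 2)) ((1 : O ⧸ I) ⊗ₜ tprod O x)) = _
  rw [piTensorBaseChange_tmul, one_smul, PiTensorProduct.congr_tprod]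
  refine congrArg _ (funext fun τ => ?_)
  rw [symPowBaseChange_tmul, one_smul, Ideal.Quotient.algebraMap_eq]

omit [CharZero E] in
/-- The integral action preserves `I · (⨂_τ Sym^{k−2}(𝒪²))`. [folklore] -/
theorem smul_top_le_comap_symLatticeAction (g : integralMonoid F v) :
    I • (⊤ : Submodule O (SymCoeffLattice O E F k)) ≤
      (I • (⊤ : Submodule O (SymCoeffLattice O E F k))).comap (symLatticeAction O E F k v φO g) := by
  rw [← Submodule.map_le_iff_le_comap, Submodule.map_smul'']
  exact Submodule.smul_mono le_rfl le_top

/-- **Reduction is equivariant**: the action induced on the quotient is the integral action of the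
`𝒪/I`-form (place maps `φO_τ mod I`). [cite: KhareThorne2017, §6.4] -/
theorem latticeQuotEquiv_symLatticeAction (g : integralMonoid F v)
    (x : SymCoeffLattice O E F k ⧸ (I • (⊤ : Submodule O (SymCoeffLattice O E F k)))) :
    latticeQuotEquiv O E F k I
        (Submodule.mapQ _ _ (symLatticeAction O E F k v φO g) (smul_top_le_comap_symLatticeAction O E F k v φO I g) x) =
      symLatticeAction (O ⧸ I) E F k v (fun τ => (Ideal.Quotient.mk I).comp (φO τ)) g
        (latticeQuotEquiv O E F k I x) := by
  induction x using Submodule.Quotient.induction_on with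
  | H y =>
    rw [Submodule.mapQ_apply]
    induction y using SymCoeffLattice.induction_on with
    | smul_tprod r x =>
      rw [map_smul, Submodule.Quotient.mk_smul, Submodule.Quotient.mk_smul, map_smul, map_smul,
        symLatticeAction_tprod, latticeQuotEquiv_mk_tprod, latticeQuotEquiv_mk_tprod,
        LinearMap.map_smul_of_tower, symLatticeAction_tprod]
      congr 1
      refine congrArg _ (funext fun τ => ?_)
      rw [symPowMap_symPowAction, intMatrixAt_map]
    | add y z hy hz =>
      rw [map_add, Submodule.Quotient.mk_add, Submodule.Quotient.mk_add, map_add, map_add, hy, hz,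
        map_add]

end Quotient

end Literature.NumberTheory.Automorphic.ParallelWeight
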